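import Literature.NumberTheory.EllipticCurves.NewformPeterssonSizeRankinSelbergProofs
import Literature.NumberTheory.EllipticCurves.Gamma0RankinSelbergPairing
import Literature.NumberTheory.EllipticCurves.ModularityVersionAp
import Literature.NumberTheory.EllipticCurves.NewformsRealCoefficients
import Literature.NumberTheory.EllipticCurves.CuspFormLFunctionLevelConductorProofs
import Literature.NumberTheory.EllipticCurves.AtkinLehnerInvolutionsProofs
import Mathlib.NumberTheory.EulerProduct.Basic
import Mathlib.NumberTheory.LSeries.RiemannZeta
import Mathlib.NumberTheory.ZetaValues
import Mathlib.NumberTheory.Harmonic.ZetaAsymp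
import HarnessLib

/-!
# The Petersson norm of a newform and its symmetric square at the edge of convergence

Topic `Literature/NumberTheory/EllipticCurves`; theorems only (no definition, no named fact).
Fourth brick (R4) of the `provefact` work on the named fact
`murty_petersson_newform_lower_bound` (`NewformPeterssonSize.lean`; Murty 1999, §2): the printed
proof writes the Petersson norm of the newform `f ∈ S₂(Γ₀(N))` of an elliptic curve as
`(f, f) = c · N · L(2, sym² f) · ∏_{p ∥ N}(…)` (Murty 1999, §2, p. 7, display; Iwaniec 2002,
§8.5: "`N⁻¹ |ν(1)|⁻²` is (up to a constant factor) the symmetric square `L`-function … at the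
point `s = 1`") and then invokes Hoffstein–Lockhart 1994 for `L(2, sym² f) ≫_ε N^{-ε}`. The
Rankin–Selberg half, `(w − 2) ∑ₙ ‖aₙ‖² n^{-w} → 48π Re(f,f)/[SL₂(ℤ):Γ₀(N)]` (`w → 2⁺`), is the
tree's `tendsto_sub_two_mul_tsum_normSq_cuspCoeff_div_rpow`
(`NewformPeterssonSizeRankinSelbergProofs`). This file supplies the Euler-product step relating
`∑ ‖aₙ‖² n^{-w}` to the (naive, good-prime) symmetric-square Euler product, for every newform
`f ∈ S₂(Γ₀(N))` (`IsNewform0`), and evaluates the latter at the edge: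

* `IsNewform0.hasProd_tsum_normSq_cuspCoeff_prime_pow` — `∑ ‖aₙ‖² n^{-w} = ∏_p ∑_e ‖a_{p^e}‖² p^{-ew}`
  for `w > 2` (multiplicativity, `IsNewform0.coeff_mul_of_coprime_holds`, and absolute
  convergence from the Rankin–Selberg range, `summable_normSq_cuspCoeff_div_rpow`);
* the local factors in closed form (`x = p^{-w}`): `1` at `p² ∣ N`, `(1 − x)⁻¹` at `p ∥ N`
  (Atkin–Lehner: `a_p = 0`, resp. `a_p = −λ(p) = ∓1`, the tree's
  `IsNewform0.cuspCoeff_eq_zero_of_sq_dvd`, `IsNewform0.atkinLehnerEigenvalueAt_eq_neg_coeff_of_not_dvd`),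
  and at `p ∤ N`, with `a = a_p ∈ ℝ` (`IsNewform0.conj_cuspCoeff`) and the Hecke recursion
  `a_{p^{e+2}} = a a_{p^{e+1}} − p a_{p^e}` (`IsNewform0.cuspCoeff_prime_pow_add_two`),
  `∑_e a_{p^e}² x^e = (1 + p x)/((1 − p x)(1 − (a² − 2p) x + p² x²))`
  (`= (1 − p²x²) · ((1 − α²x)(1 − αβx)(1 − β²x))⁻¹`, `α + β = a`, `αβ = p`): the squares of a
  binary linear recurrence satisfy the ternary recurrence with roots `α², αβ, β²`
  (`IsNewform0.tsum_normSq_cuspCoeff_prime_pow_mul_eq`); the cubic is *positive* at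
  `x = p^{-w}`, `w > 2`, because the series is `≥ 1` (`IsNewform0.symmSqLocalFactor_inv_pos`) —
  no Ramanujan bound is used anywhere;
* `IsNewform0.hasProd_symmSq` — for `w > 2` the good-prime product of the naive symmetric-square
  factors converges to `(∑ ‖aₙ‖² n^{-w}) ∏_{p∣N}(1 − ‖a_p‖² p^{-w}) ζ_N(2w − 2)/ζ_N(w − 1)`
  (`ζ_N(s) = ζ(s)∏_{p∣N}(1 − p^{-s})`, real `ζ(s) = ∑ n^{-s}`; Bump 1997, §3.9:
  `L_S(s, π × π) = L_S(s, π, ∨²) L_S(s, π, ∧²)`, here `∧² = 1`);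
* `IsNewform0.tendsto_tprod_symmSq` — **as `w → 2⁺` that product tends to
  `(8π³/N) ∏_{p ∥ N}(1 − p^{-2}) Re(f, f)`** (the residue above, `(s − 1)ζ(s) → 1`,
  `ζ(2) = π²/6`, `[SL₂(ℤ):Γ₀(N)] = N∏_{p∣N}(1 + 1/p)`);
* `murty_petersson_newform_lower_bound_of_symmSq_lower_bound` — the fact follows from the
  printed Hoffstein–Lockhart input in this form: a lower bound `≥ c_ε N^{-ε}` for the limit of the
  naive symmetric-square product at `w → 2⁺` for newforms of elliptic curves over `ℚ`;
  `IsNewformOf.tendsto_tprod_symmSq`, `murty_petersson_newform_lower_bound_of_symmSq_lower_bound_lFunction`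
  — the same with the Euler product written in the integers `a_p(W)` of the curve.

Real-variable `ζ` utilities (`hasProd_one_sub_prime_rpow_neg_inv`, `riemannZeta_ofReal_eq_tsum`,
`tendsto_sub_one_mul_tsum_one_div_nat_rpow`, `continuousAt_tsum_one_div_nat_rpow`,
`tsum_one_div_nat_rpow_two`) are derived from Mathlib's complex `riemannZeta`.

## References

* M. R. Murty, *Bounds for congruence primes*, Proc. Sympos. Pure Math. 66.1 (1999), §2 p. 7,
  §6 Lemma 9. [Murty1999CongruencePrimes]
* R. A. Rankin, *Contributions to the theory of Ramanujan's function τ(n) … II*, Proc. Cambridge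
  Philos. Soc. 35 (1939). [Rankin1939]
* D. Bump, *Automorphic forms and representations* (1997), §3.9 (PDF p. 382). [Bump1997]
* H. Iwaniec, *Spectral methods of automorphic forms*, 2nd ed. (2002), §8.5. [Iwaniec2002]
* A. O. L. Atkin, J. Lehner, *Hecke operators on Γ₀(m)*, Math. Ann. 185 (1970), Thm. 3.
  [AtkinLehner1970]
* A. W. Knapp, *Elliptic curves* (1993), Thm. 9.27. [Knapp1993]
* J. Hoffstein, P. Lockhart, *Coefficients of Maass forms and the Siegel zero* (appendix by
  D. Goldfeld, J. Hoffstein, D. Lieman), Ann. of Math. 140 (1994). [HoffsteinLockhart1994]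
-/

noncomputable section

open scoped MatrixGroups ModularForm Real Topology
open Filter CongruenceSubgroup

namespace Literature.NumberTheory.EllipticCurves.ModularForms

variable {N : ℕ} [NeZero N]

section Coefficients

variable {k : ℤ} {f : CuspForm (Gamma0 N) k}

/-- `‖aₙ(f)‖² = (Re aₙ(f))²` for a newform on `Γ₀(N)` (its coefficients are real,
`IsNewform0.cuspCoeff_im_eq_zero`). [folklore] -/
theorem IsNewform0.norm_cuspCoeff_sq (hf : IsNewform0 f) (n : ℕ) :
    ‖cuspCoeff f n‖ ^ 2 = (cuspCoeff f n).re ^ 2 := by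
  rw [hf.cuspCoeff_eq_ofReal_re n, Complex.norm_real, Real.norm_eq_abs, sq_abs, Complex.ofReal_re]

/-- `a₁(f) = 1` on real parts. [folklore] -/
theorem IsNewform0.re_cuspCoeff_one (hf : IsNewform0 f) : (cuspCoeff f 1).re = 1 := by
  rw [show cuspCoeff f 1 = 1 from hf.2.2, Complex.one_re]

/-- Multiplicativity of the (real) coefficients of a newform: `a_{mn} = a_m a_n` for coprime
`m, n` (`IsNewform0.coeff_mul_of_coprime_holds`). [folklore] -/
theorem IsNewform0.re_cuspCoeff_mul_of_coprime (hf : IsNewform0 f) {m n : ℕ} (hmn : m.Coprime n) :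
    (cuspCoeff f (m * n)).re = (cuspCoeff f m).re * (cuspCoeff f n).re := by
  have h : cuspCoeff f (m * n) = cuspCoeff f m * cuspCoeff f n :=
    IsNewform0.coeff_mul_of_coprime_holds hf hmn
  rw [h, Complex.mul_re, hf.cuspCoeff_im_eq_zero m, zero_mul, sub_zero]

end Coefficients

section WeightTwo

variable {f : CuspForm (Gamma0 N) 2}

/-- Prime-power recursion on real parts in weight `2`:
`a_{p^{e+2}} = a_p a_{p^{e+1}} − 𝟙_N(p) p a_{p^e}` (`IsNewform0.cuspCoeff_prime_pow_add_two`). [folklore] -/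
theorem IsNewform0.re_cuspCoeff_prime_pow_add_two (hf : IsNewform0 f) {p : ℕ} (hp : p.Prime) (e : ℕ) :
    (cuspCoeff f (p ^ (e + 2))).re = (cuspCoeff f p).re * (cuspCoeff f (p ^ (e + 1))).re -
      (if p ∣ N then 0 else (p : ℝ)) * (cuspCoeff f (p ^ e)).re := by
  have h := hf.cuspCoeff_prime_pow_add_two hp e
  rw [h, Complex.sub_re, Complex.mul_re, hf.cuspCoeff_im_eq_zero p, zero_mul, sub_zero]
  congr 1
  split_ifs
  · simp
  · rw [Complex.mul_re, Complex.natCast_re, Complex.natCast_im, zero_mul, sub_zero]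

/-- At a prime `p` with `p² ∣ N`: `a_{p^e}(f) = 0` for `e ≥ 1` (Atkin–Lehner 1970, Thm. 3:
`a_p = 0`, and `a_{p^{e+2}} = a_p a_{p^{e+1}}`). [cite: AtkinLehner1970, Thm. 3] -/
theorem IsNewform0.cuspCoeff_prime_pow_eq_zero_of_sq_dvd (hf : IsNewform0 f) {p : ℕ} (hp : p.Prime)
    (hp2 : p ^ 2 ∣ N) (e : ℕ) : cuspCoeff f (p ^ (e + 1)) = 0 := by
  have hpN : p ∣ N := (dvd_pow_self p two_ne_zero).trans hp2
  induction e with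
  | zero => rw [zero_add, pow_one]; exact hf.cuspCoeff_eq_zero_of_sq_dvd hp hp2
  | succ e ih =>
    rw [show e + 1 + 1 = e + 2 from rfl, hf.cuspCoeff_prime_pow_add_two hp e, if_pos hpN, ih]
    ring

/-- At a prime `p ∥ N` (`p ∣ N`, `p² ∤ N`), in weight `2`: `a_p(f)² = 1` (Atkin–Lehner 1970,
Thm. 3 / Knapp 1993, Thm. 9.27: `a_p = −λ(p)` with `λ(p) = ±1` the Atkin–Lehner eigenvalue;
`IsNewform0.atkinLehnerEigenvalueAt_eq_neg_coeff_of_not_dvd`). [cite: Knapp1993, Thm. 9.27] -/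
theorem IsNewform0.cuspCoeff_sq_eq_one_of_dvd_of_not_sq_dvd (hf : IsNewform0 f) {p : ℕ}
    (hp : p.Prime) (hpN : p ∣ N) (hp2 : ¬ p ^ 2 ∣ N) : cuspCoeff f p ^ 2 = 1 := by
  haveI : Fact p.Prime := ⟨hp⟩
  obtain ⟨M, hN⟩ := hpN
  have hpM : ¬ p ∣ M := fun ⟨M', h⟩ ↦ hp2 ⟨M', by rw [hN, h]; ring⟩
  obtain ⟨ε, hε1, hε⟩ := hf.exists_atkinLehnerInvolutionAt_eq_smul_of_not_dvd p hN hpM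
  have hf0 : f ≠ 0 := IsNormalized.ne_zero_gamma0 hf.2.2
  have h1 : atkinLehnerEigenvalueAt f p = ε := atkinLehnerEigenvalueAt_eq_of_eq_smul hf0 hε
  have h2 : atkinLehnerEigenvalueAt f p = -cuspCoeff f p :=
    hf.atkinLehnerEigenvalueAt_eq_neg_coeff_of_not_dvd p hN hpM
  have h3 : cuspCoeff f p = -ε := by rw [← h1, h2, neg_neg]
  rcases hε1 with rfl | rfl
  · rw [h3]; norm_num
  · rw [h3]; norm_num

/-- At a prime `p ∣ N`: `a_{p^e}(f) = a_p(f)^e` (`a_{p^{e+2}} = a_p a_{p^{e+1}}` when `p ∣ N`).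
[folklore] -/
theorem IsNewform0.cuspCoeff_prime_pow_of_dvd (hf : IsNewform0 f) {p : ℕ} (hp : p.Prime)
    (hpN : p ∣ N) (e : ℕ) : cuspCoeff f (p ^ e) = cuspCoeff f p ^ e := by
  induction e using Nat.strong_induction_on with
  | _ e ih =>
    match e with
    | 0 => rw [pow_zero, pow_zero]; exact hf.2.2
    | 1 => rw [pow_one, pow_one]
    | e + 2 =>
      rw [hf.cuspCoeff_prime_pow_add_two hp e, if_pos hpN, ih (e + 1) (by omega), zero_mul,
        sub_zero]
      ring

/-- At a prime `p ∣ N`, in weight `2`: `‖a_{p^e}(f)‖² = (‖a_p(f)‖²)^e` with `‖a_p(f)‖² = 0` if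
`p² ∣ N` and `= 1` if `p ∥ N` (Atkin–Lehner 1970, Thm. 3). [cite: AtkinLehner1970, Thm. 3] -/
theorem IsNewform0.norm_cuspCoeff_sq_of_dvd (hf : IsNewform0 f) {p : ℕ} (hp : p.Prime) (hpN : p ∣ N) :
    ‖cuspCoeff f p‖ ^ 2 = if p ^ 2 ∣ N then 0 else 1 := by
  split_ifs with h
  · rw [hf.cuspCoeff_eq_zero_of_sq_dvd hp h, norm_zero, zero_pow two_ne_zero]
  · rw [← Complex.norm_pow, hf.cuspCoeff_sq_eq_one_of_dvd_of_not_sq_dvd hp hpN h, norm_one]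

/-! ### Summability of `∑ ‖aₙ‖² n^{-w}` for `w > 2` (Rankin–Selberg) -/

omit [NeZero N] in
/-- `‖aₙ‖²/n^w = ‖aₙ‖² (1/(4πn))^w Γ(w) · ((4π)^w/Γ(w))` termwise (`w > 0`). [folklore] -/
theorem normSq_cuspCoeff_div_rpow_eq (f : CuspForm (Gamma0 N) 2) {w : ℝ} (hw : 0 < w) (n : ℕ) :
    ‖cuspCoeff f n‖ ^ 2 / (n : ℝ) ^ w =
      ‖cuspCoeff f n‖ ^ 2 * ((1 / (4 * π * n)) ^ w * Real.Gamma w) * ((4 * π) ^ w / Real.Gamma w) := by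
  have hΓ : Real.Gamma w ≠ 0 := (Real.Gamma_pos_of_pos hw).ne'
  have h4π : (0 : ℝ) < 4 * π := by positivity
  rcases Nat.eq_zero_or_pos n with rfl | hn
  · simp [Real.zero_rpow hw.ne']
  · have hn' : (0 : ℝ) < n := by exact_mod_cast hn
    rw [one_div, Real.inv_rpow (by positivity), Real.mul_rpow h4π.le hn'.le]
    field_simp

/-- **`∑ₙ ‖aₙ(f)‖² n^{-w}` converges for every `w > 2`** and every `f ∈ S₂(Γ₀(N))` (Rankin 1939:
the Rankin–Selberg Dirichlet series converges to the right of its pole `w = k = 2`; here from the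
tree's `summable_normSq_cuspCoeff_mul_rpow`, the range `2 < w < 4`, and comparison with `w = 3`
beyond). [cite: Rankin1939, convergence of Σ|aₙ|²n^{-s} for Re s > k] -/
theorem summable_normSq_cuspCoeff_div_rpow (f : CuspForm (Gamma0 N) 2) {w : ℝ} (hw : 2 < w) :
    Summable fun n : ℕ ↦ ‖cuspCoeff f n‖ ^ 2 / (n : ℝ) ^ w := by
  -- the range `2 < w < 4` straight from Rankin–Selberg
  have key : ∀ w : ℝ, 2 < w → w < 4 → Summable fun n : ℕ ↦ ‖cuspCoeff f n‖ ^ 2 / (n : ℝ) ^ w := by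
    intro w hw2 hw4
    have h := summable_normSq_cuspCoeff_mul_rpow (k := 2) (by norm_num) f (s := w - 1)
      (by linarith) (by linarith)
    have h' : Summable fun n : ℕ ↦
        ‖cuspCoeff f n‖ ^ 2 * ((1 / (4 * π * n)) ^ w * Real.Gamma w) * ((4 * π) ^ w / Real.Gamma w) := by
      refine (h.mul_right ((4 * π) ^ w / Real.Gamma w)).congr fun n ↦ ?_
      push_cast
      rw [show w - 1 + 2 - 1 = w by ring]
    refine h'.congr fun n ↦ ?_
    rw [normSq_cuspCoeff_div_rpow_eq f (by linarith) n]
  by_cases hw4 : w < 4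
  · exact key w hw hw4
  · push Not at hw4
    have h3 := key 3 (by norm_num) (by norm_num)
    refine Summable.of_nonneg_of_le (fun n ↦ by positivity) (fun n ↦ ?_) h3
    rcases Nat.eq_zero_or_pos n with rfl | hn
    · simp [Real.zero_rpow (show (w : ℝ) ≠ 0 by linarith), Real.zero_rpow (show (3 : ℝ) ≠ 0 by norm_num)]
    · have hn' : (1 : ℝ) ≤ n := by exact_mod_cast hn
      exact div_le_div_of_nonneg_left (by positivity) (by positivity)
        (Real.rpow_le_rpow_of_exponent_le hn' (by linarith))

/-! ### The Euler product of `∑ ‖aₙ‖² n^{-w}` -/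

/-- **Euler product of the Rankin–Selberg Dirichlet series of a newform**: for `f ∈ S₂(Γ₀(N))` a
newform and `w > 2`, `∑ₙ ‖aₙ‖² n^{-w} = ∏_p ∑_e ‖a_{p^e}‖² p^{-ew}` (multiplicativity of the
coefficients, Atkin–Lehner 1970 Thm. 3, and absolute convergence, Rankin 1939).
[cite: Rankin1939, convergence of Σ|aₙ|²n^{-s} for Re s > k] -/
theorem IsNewform0.hasProd_tsum_normSq_cuspCoeff_prime_pow (hf : IsNewform0 f) {w : ℝ} (hw : 2 < w) :
    HasProd (fun p : Nat.Primes ↦ ∑' e : ℕ, ‖cuspCoeff f ((p : ℕ) ^ e)‖ ^ 2 / (((p : ℕ) ^ e : ℕ) : ℝ) ^ w)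
      (∑' n : ℕ, ‖cuspCoeff f n‖ ^ 2 / (n : ℝ) ^ w) := by
  have hw0 : w ≠ 0 := by linarith
  refine EulerProduct.eulerProduct_hasProd (f := fun n : ℕ ↦ ‖cuspCoeff f n‖ ^ 2 / (n : ℝ) ^ w)
    ?_ ?_ ?_ ?_
  · simp [show cuspCoeff f 1 = 1 from hf.2.2]
  · intro m n hmn
    have h : cuspCoeff f (m * n) = cuspCoeff f m * cuspCoeff f n :=
      IsNewform0.coeff_mul_of_coprime_holds hf hmn
    rw [h, norm_mul, Nat.cast_mul, Real.mul_rpow (Nat.cast_nonneg m) (Nat.cast_nonneg n)]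
    ring
  · refine (summable_normSq_cuspCoeff_div_rpow f hw).congr fun n ↦ ?_
    rw [Real.norm_of_nonneg (by positivity)]
  · simp [Real.zero_rpow hw0]

/-- The local factor at a prime `p` with `p² ∣ N` is `1`: `∑_e ‖a_{p^e}‖² x^e = 1`
(`a_{p^e} = 0` for `e ≥ 1`). [cite: AtkinLehner1970, Thm. 3] -/
theorem IsNewform0.tsum_normSq_cuspCoeff_prime_pow_of_sq_dvd (hf : IsNewform0 f) {p : ℕ} (hp : p.Prime)
    (hp2 : p ^ 2 ∣ N) (x : ℝ) :
    ∑' e : ℕ, ‖cuspCoeff f (p ^ e)‖ ^ 2 * x ^ e = 1 := by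
  have h0 : ∀ e : ℕ, ‖cuspCoeff f (p ^ (e + 1))‖ ^ 2 * x ^ (e + 1) = 0 := fun e ↦ by
    rw [hf.cuspCoeff_prime_pow_eq_zero_of_sq_dvd hp hp2 e, norm_zero, zero_pow two_ne_zero, zero_mul]
  rw [tsum_eq_zero_add' (by simp_rw [h0]; exact summable_zero)]
  simp_rw [h0, tsum_zero, add_zero, pow_zero, show cuspCoeff f 1 = 1 from hf.2.2, norm_one, one_pow,
    mul_one]

/-- The local factor at a prime `p ∥ N` is geometric: `∑_e ‖a_{p^e}‖² x^e = (1 − x)⁻¹` for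
`0 ≤ x < 1` (`‖a_{p^e}‖² = 1`). [cite: AtkinLehner1970, Thm. 3] -/
theorem IsNewform0.hasSum_normSq_cuspCoeff_prime_pow_of_dvd_of_not_sq_dvd (hf : IsNewform0 f) {p : ℕ}
    (hp : p.Prime) (hpN : p ∣ N) (hp2 : ¬ p ^ 2 ∣ N) {x : ℝ} (hx0 : 0 ≤ x) (hx1 : x < 1) :
    HasSum (fun e : ℕ ↦ ‖cuspCoeff f (p ^ e)‖ ^ 2 * x ^ e) (1 - x)⁻¹ := by
  have h1 : ∀ e : ℕ, ‖cuspCoeff f (p ^ e)‖ ^ 2 = 1 := fun e ↦ by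
    rw [hf.cuspCoeff_prime_pow_of_dvd hp hpN e, norm_pow, ← pow_mul, mul_comm, pow_mul,
      hf.norm_cuspCoeff_sq_of_dvd hp hpN, if_neg hp2, one_pow]
  simp_rw [h1, one_mul]
  exact hasSum_geometric_of_lt_one hx0 hx1

/-- Unified local factor at a bad prime `p ∣ N`: `∑_e ‖a_{p^e}‖² x^e = (1 − ‖a_p‖² x)⁻¹`
(`0 ≤ x < 1`; `‖a_p‖² ∈ {0, 1}`). [cite: AtkinLehner1970, Thm. 3] -/
theorem IsNewform0.tsum_normSq_cuspCoeff_prime_pow_of_dvd (hf : IsNewform0 f) {p : ℕ} (hp : p.Prime)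
    (hpN : p ∣ N) {x : ℝ} (hx0 : 0 ≤ x) (hx1 : x < 1) :
    ∑' e : ℕ, ‖cuspCoeff f (p ^ e)‖ ^ 2 * x ^ e = (1 - ‖cuspCoeff f p‖ ^ 2 * x)⁻¹ := by
  rw [hf.norm_cuspCoeff_sq_of_dvd hp hpN]
  split_ifs with h
  · rw [hf.tsum_normSq_cuspCoeff_prime_pow_of_sq_dvd hp h, zero_mul, sub_zero, inv_one]
  · rw [(hf.hasSum_normSq_cuspCoeff_prime_pow_of_dvd_of_not_sq_dvd hp hpN h hx0 hx1).tsum_eq, one_mul]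

/-- **The local factor at a good prime `p ∤ N`** (Rankin 1939; Shimura 1975): writing
`a = a_p(f) ∈ ℝ` and `c_e = ‖a_{p^e}‖² = a_{p^e}²`, the squares of the solution of
`u_{e+2} = a u_{e+1} − p u_e` satisfy the order-three recursion with characteristic roots
`α², αβ = p, β²`, whence, whenever `∑_e c_e x^e` converges,
`(∑_e c_e x^e) · (1 − p x)(1 − (a² − 2p) x + p² x²) = 1 + p x`; in particular the cubic is nonzero
and `∑_e c_e x^e = (1 + p x) / ((1 − p x)(1 − (a² − 2p) x + p² x²))`, i.e.
`(1 − p²x²) · L_p(x)` with `L_p(x)⁻¹ = (1 − α²x)(1 − αβ x)(1 − β²x)` the (naive) symmetric-square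
Euler factor (Bump 1997, §3.9: `L_S(s, π × π) = L_S(s, π, ∨²) L_S(s, π, ∧²)`, the local identity at
a good prime, `∧² = 1` here). [cite: Bump1997, §3.9 (PDF p. 382)] -/
theorem IsNewform0.tsum_normSq_cuspCoeff_prime_pow_mul_eq (hf : IsNewform0 f) {p : ℕ} (hp : p.Prime)
    (hpN : ¬ p ∣ N) {x : ℝ} (hs : Summable fun e : ℕ ↦ ‖cuspCoeff f (p ^ e)‖ ^ 2 * x ^ e) :
    (∑' e : ℕ, ‖cuspCoeff f (p ^ e)‖ ^ 2 * x ^ e) *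
        ((1 - p * x) * (1 - (‖cuspCoeff f p‖ ^ 2 - 2 * p) * x + (p : ℝ) ^ 2 * x ^ 2)) =
      1 + p * x := by
  -- real coefficients `u e = a_{p^e}`, so that `‖a_{p^e}‖² = (u e)²`
  obtain ⟨u, hu⟩ : ∃ u : ℕ → ℝ, ∀ e, (cuspCoeff f (p ^ e)).re = u e := ⟨_, fun _ ↦ rfl⟩
  have hc : ∀ e, ‖cuspCoeff f (p ^ e)‖ ^ 2 = u e ^ 2 := fun e ↦ by rw [hf.norm_cuspCoeff_sq, hu]
  have hu0 : u 0 = 1 := by rw [← hu, pow_zero, hf.re_cuspCoeff_one]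
  have hp1 : (cuspCoeff f p).re = u 1 := by rw [← hu 1, pow_one]
  have hA2 : ‖cuspCoeff f p‖ ^ 2 = u 1 ^ 2 := by rw [← hc 1, pow_one]
  have hrec : ∀ e, u (e + 2) = u 1 * u (e + 1) - p * u e := fun e ↦ by
    have h := hf.re_cuspCoeff_prime_pow_add_two hp e
    simp only [if_neg hpN, hu, hp1] at h
    exact h
  have hu2 : u 2 = u 1 ^ 2 - p := by
    have h := hrec 0
    rw [zero_add, zero_add, hu0, mul_one] at h
    rw [h]; ring
  -- the order-three recursion for the squares (roots `α², αβ = p, β²`)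
  have hsq : ∀ e, u (e + 3) ^ 2 =
      (u 1 ^ 2 - p) * u (e + 2) ^ 2 - (p * u 1 ^ 2 - (p : ℝ) ^ 2) * u (e + 1) ^ 2 +
        (p : ℝ) ^ 3 * u e ^ 2 := by
    intro e
    have h2 : u (e + 2) = u 1 * u (e + 1) - p * u e := hrec e
    have h3 : u (e + 3) = u 1 * u (e + 2) - p * u (e + 1) := hrec (e + 1)
    rw [h3, h2]
    ring
  simp_rw [hc] at hs ⊢
  rw [hA2]
  obtain ⟨S, hS⟩ : ∃ S : ℝ, HasSum (fun e : ℕ ↦ u e ^ 2 * x ^ e) S := ⟨_, hs.hasSum⟩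
  rw [hS.tsum_eq]
  -- shifted sums
  have h1 : HasSum (fun e : ℕ ↦ u (e + 1) ^ 2 * x ^ (e + 1))
      (S - ∑ i ∈ Finset.range 1, u i ^ 2 * x ^ i) := (hasSum_nat_add_iff' 1).mpr hS
  have h2 : HasSum (fun e : ℕ ↦ u (e + 2) ^ 2 * x ^ (e + 2))
      (S - ∑ i ∈ Finset.range 2, u i ^ 2 * x ^ i) := (hasSum_nat_add_iff' 2).mpr hS
  have h3 : HasSum (fun e : ℕ ↦ u (e + 3) ^ 2 * x ^ (e + 3))
      (S - ∑ i ∈ Finset.range 3, u i ^ 2 * x ^ i) := (hasSum_nat_add_iff' 3).mpr hS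
  -- the recursion inside the third shifted sum
  have hfun : (fun e : ℕ ↦ u (e + 3) ^ 2 * x ^ (e + 3)) = fun e : ℕ ↦
      (u 1 ^ 2 - p) * x * (u (e + 2) ^ 2 * x ^ (e + 2)) -
        (p * u 1 ^ 2 - (p : ℝ) ^ 2) * x ^ 2 * (u (e + 1) ^ 2 * x ^ (e + 1)) +
        (p : ℝ) ^ 3 * x ^ 3 * (u e ^ 2 * x ^ e) := by
    funext e
    rw [hsq e]
    ring
  have h3' : HasSum (fun e : ℕ ↦ u (e + 3) ^ 2 * x ^ (e + 3))
      ((u 1 ^ 2 - p) * x * (S - ∑ i ∈ Finset.range 2, u i ^ 2 * x ^ i) -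
        (p * u 1 ^ 2 - (p : ℝ) ^ 2) * x ^ 2 * (S - ∑ i ∈ Finset.range 1, u i ^ 2 * x ^ i) +
        (p : ℝ) ^ 3 * x ^ 3 * S) := by
    rw [hfun]
    exact ((h2.mul_left ((u 1 ^ 2 - p) * x)).sub
      (h1.mul_left ((p * u 1 ^ 2 - (p : ℝ) ^ 2) * x ^ 2))).add (hS.mul_left ((p : ℝ) ^ 3 * x ^ 3))
  have heq := h3.unique h3'
  simp only [Finset.sum_range_succ, Finset.sum_range_zero, zero_add, pow_zero, pow_one, hu0, hu2,
    one_pow, one_mul] at heq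
  linear_combination heq

/-- **Positivity of the naive symmetric-square Euler factor at a good prime.** For `p ∤ N` and
`x ≥ 0` with `∑_e ‖a_{p^e}‖² x^e` convergent, the cubic
`(1 − p x)(1 − (‖a_p‖² − 2p) x + p² x²)` is positive (it equals `(1 + p x)/∑_e ‖a_{p^e}‖² x^e` with a
sum `≥ 1`). No Ramanujan bound is used. [folklore] -/
theorem IsNewform0.symmSqLocalFactor_inv_pos (hf : IsNewform0 f) {p : ℕ} (hp : p.Prime)
    (hpN : ¬ p ∣ N) {x : ℝ} (hx : 0 ≤ x) (hs : Summable fun e : ℕ ↦ ‖cuspCoeff f (p ^ e)‖ ^ 2 * x ^ e) :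
    0 < (1 - p * x) * (1 - (‖cuspCoeff f p‖ ^ 2 - 2 * p) * x + (p : ℝ) ^ 2 * x ^ 2) := by
  have h := hf.tsum_normSq_cuspCoeff_prime_pow_mul_eq hp hpN hs
  have hS : 0 < ∑' e : ℕ, ‖cuspCoeff f (p ^ e)‖ ^ 2 * x ^ e := by
    refine lt_of_lt_of_le zero_lt_one ?_
    have h0 : (1 : ℝ) = ‖cuspCoeff f (p ^ 0)‖ ^ 2 * x ^ 0 := by
      simp [show cuspCoeff f 1 = 1 from hf.2.2]
    rw [h0]
    exact hs.le_tsum 0 fun e _ ↦ by positivity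
  have hR : 0 < 1 + (p : ℝ) * x := by positivity
  by_contra hle
  push Not at hle
  have := mul_nonpos_of_nonneg_of_nonpos hS.le hle
  linarith

/-- **The good local factor in closed form**: for `p ∤ N`, `x ≥ 0` with `∑_e ‖a_{p^e}‖² x^e`
convergent, `∑_e ‖a_{p^e}‖² x^e = (1 + p x) / ((1 − p x)(1 − (‖a_p‖² − 2p) x + p² x²))`
(the factorisation `∑ a_{p^e}² x^e = (1 − p²x²) L_p(Sym² f, x)`; Bump 1997, §3.9).
[cite: Bump1997, §3.9 (PDF p. 382)] -/
theorem IsNewform0.tsum_normSq_cuspCoeff_prime_pow_of_not_dvd (hf : IsNewform0 f) {p : ℕ} (hp : p.Prime)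
    (hpN : ¬ p ∣ N) {x : ℝ} (hx : 0 ≤ x) (hs : Summable fun e : ℕ ↦ ‖cuspCoeff f (p ^ e)‖ ^ 2 * x ^ e) :
    ∑' e : ℕ, ‖cuspCoeff f (p ^ e)‖ ^ 2 * x ^ e =
      (1 + p * x) / ((1 - p * x) * (1 - (‖cuspCoeff f p‖ ^ 2 - 2 * p) * x + (p : ℝ) ^ 2 * x ^ 2)) := by
  have h := hf.tsum_normSq_cuspCoeff_prime_pow_mul_eq hp hpN hs
  have hQ := hf.symmSqLocalFactor_inv_pos hp hpN hx hs
  rw [eq_div_iff hQ.ne', h]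

end WeightTwo

/-! ### Real Euler products: `ζ(s) = ∏_p (1 − p^{-s})⁻¹` for real `s > 1`, and finite modifications -/

/-- Inverting a convergent infinite product of reals with nonzero value. [folklore] -/
theorem hasProd_inv_of_hasProd {ι : Type*} {g : ι → ℝ} {a : ℝ} (h : HasProd g a) (ha : a ≠ 0) :
    HasProd (fun i ↦ (g i)⁻¹) a⁻¹ := by
  have h' : Tendsto (fun s : Finset ι ↦ ∏ i ∈ s, g i) atTop (𝓝 a) := h
  have h'' := h'.inv₀ ha
  have : (fun s : Finset ι ↦ (∏ i ∈ s, g i)⁻¹) = fun s ↦ ∏ i ∈ s, (g i)⁻¹ := by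
    funext s; rw [Finset.prod_inv_distrib]
  rw [this] at h''
  exact h''

/-- **Euler product of `ζ(s)` over the reals**: for real `s > 1`,
`∏_p (1 − p^{-s})⁻¹ = ∑_{n ≥ 1} n^{-s}` as a convergent product over `Nat.Primes` (Mathlib's
`EulerProduct.eulerProduct_completely_multiplicative_hasProd` for `n ↦ n^{-s}`). [folklore] -/
theorem hasProd_one_sub_prime_rpow_neg_inv {s : ℝ} (hs : 1 < s) :
    HasProd (fun p : Nat.Primes ↦ (1 - (p : ℝ) ^ (-s))⁻¹) (∑' n : ℕ, 1 / (n : ℝ) ^ s) := by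
  have hs0 : -s ≠ 0 := by linarith
  let F : ℕ →*₀ ℝ :=
    { toFun := fun n ↦ (n : ℝ) ^ (-s)
      map_zero' := by simp [Real.zero_rpow hs0]
      map_one' := by simp
      map_mul' := fun m n ↦ by
        simp only [Nat.cast_mul]
        exact Real.mul_rpow (Nat.cast_nonneg m) (Nat.cast_nonneg n) }
  have hF : ∀ n : ℕ, F n = (n : ℝ) ^ (-s) := fun n ↦ rfl
  have hsum : Summable fun n ↦ ‖F n‖ := by
    refine (Real.summable_nat_rpow.mpr (by linarith : -s < -1)).congr fun n ↦ ?_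
    rw [hF, Real.norm_of_nonneg (Real.rpow_nonneg (Nat.cast_nonneg n) _)]
  have h := EulerProduct.eulerProduct_completely_multiplicative_hasProd hsum
  have heq : (∑' n : ℕ, F n) = ∑' n : ℕ, 1 / (n : ℝ) ^ s :=
    tsum_congr fun n ↦ by rw [hF, Real.rpow_neg (Nat.cast_nonneg n), one_div]
  rw [heq] at h
  exact h

/-- `∑_{n ≥ 1} n^{-s} > 0` for real `s > 1` (the term `n = 1` is `1`). [folklore] -/
theorem tsum_one_div_nat_rpow_pos {s : ℝ} (hs : 1 < s) : 0 < ∑' n : ℕ, 1 / (n : ℝ) ^ s := by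
  have hsum : Summable fun n : ℕ ↦ 1 / (n : ℝ) ^ s := Real.summable_one_div_nat_rpow.mpr hs
  have h := hsum.le_tsum 1 fun n _ ↦ by positivity
  simp only [Nat.cast_one, Real.one_rpow, div_one] at h
  exact lt_of_lt_of_le zero_lt_one h

/-- For real `s > 1`, Mathlib's `riemannZeta s` is the real number `∑_{n ≥ 1} n^{-s}`. [folklore] -/
theorem riemannZeta_ofReal_eq_tsum {s : ℝ} (hs : 1 < s) :
    riemannZeta (s : ℂ) = ((∑' n : ℕ, 1 / (n : ℝ) ^ s : ℝ) : ℂ) := by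
  rw [zeta_eq_tsum_one_div_nat_cpow (by simpa using hs), Complex.ofReal_tsum]
  refine tsum_congr fun n ↦ ?_
  rw [Complex.ofReal_div, Complex.ofReal_one, Complex.ofReal_cpow (Nat.cast_nonneg n),
    Complex.ofReal_natCast]

/-- **`(s − 1) ζ(s) → 1` as `s → 1⁺` through real values** (from Mathlib's complex
`riemannZeta_residue_one`). [folklore] -/
theorem tendsto_sub_one_mul_tsum_one_div_nat_rpow :
    Tendsto (fun s : ℝ ↦ (s - 1) * ∑' n : ℕ, 1 / (n : ℝ) ^ s) (𝓝[>] 1) (𝓝 1) := by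
  have hmap : Tendsto (fun s : ℝ ↦ (s : ℂ)) (𝓝[>] 1) (𝓝[≠] 1) := by
    refine (Complex.continuous_ofReal.continuousWithinAt.tendsto_nhdsWithin ?_)
    intro s hs
    simp only [Set.mem_Ioi] at hs
    simp only [Set.mem_compl_iff, Set.mem_singleton_iff, Complex.ofReal_eq_one]
    exact ne_of_gt hs
  have h := (Complex.continuous_re.tendsto 1).comp (riemannZeta_residue_one.comp hmap)
  rw [Complex.one_re] at h
  refine h.congr' ?_
  filter_upwards [self_mem_nhdsWithin] with s hs
  simp only [Set.mem_Ioi] at hs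
  simp only [Function.comp_apply]
  rw [riemannZeta_ofReal_eq_tsum hs, show (s : ℂ) - 1 = ((s - 1 : ℝ) : ℂ) by push_cast; ring,
    ← Complex.ofReal_mul, Complex.ofReal_re]

/-- `s ↦ ∑_{n ≥ 1} n^{-s}` is continuous at every real `s > 1` (it is `ζ` there). [folklore] -/
theorem continuousAt_tsum_one_div_nat_rpow {s : ℝ} (hs : 1 < s) :
    ContinuousAt (fun t : ℝ ↦ ∑' n : ℕ, 1 / (n : ℝ) ^ t) s := by
  have h1 : ContinuousAt (fun t : ℝ ↦ (riemannZeta (t : ℂ)).re) s := by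
    refine Complex.continuous_re.continuousAt.comp ?_
    refine ContinuousAt.comp (g := riemannZeta) ?_ Complex.continuous_ofReal.continuousAt
    exact (differentiableAt_riemannZeta (by
      simp only [ne_eq, Complex.ofReal_eq_one]; exact ne_of_gt hs)).continuousAt
  refine h1.congr ?_
  filter_upwards [Ioi_mem_nhds hs] with t ht
  simp only [Set.mem_Ioi] at ht
  rw [riemannZeta_ofReal_eq_tsum ht, Complex.ofReal_re]

/-- `∑_{n ≥ 1} n^{-2} = π²/6` (Mathlib `hasSum_zeta_two`), in the real-exponent form. [folklore] -/
theorem tsum_one_div_nat_rpow_two : ∑' n : ℕ, 1 / (n : ℝ) ^ (2 : ℝ) = π ^ 2 / 6 := by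
  rw [← hasSum_zeta_two.tsum_eq]
  exact tsum_congr fun n ↦ by rw [Real.rpow_two]



section SymmSquare

variable {f : CuspForm (Gamma0 N) 2}

omit [NeZero N] in
/-- `‖a_{p^e}‖² / (p^e)^w = ‖a_{p^e}‖² · (p^{-w})^e`. [folklore] -/
theorem normSq_cuspCoeff_prime_pow_div_eq (f : CuspForm (Gamma0 N) 2) (p e : ℕ) (w : ℝ) :
    ‖cuspCoeff f (p ^ e)‖ ^ 2 / (((p ^ e : ℕ) : ℝ)) ^ w =
      ‖cuspCoeff f (p ^ e)‖ ^ 2 * ((p : ℝ) ^ (-w)) ^ e := by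
  have hp : (0 : ℝ) ≤ p := Nat.cast_nonneg p
  rw [div_eq_mul_inv, Nat.cast_pow, ← Real.rpow_natCast (p : ℝ) e, ← Real.rpow_mul hp,
    ← Real.rpow_natCast ((p : ℝ) ^ (-w)) e, ← Real.rpow_mul hp, ← Real.rpow_neg hp]
  congr 1
  ring

/-- The prime-power subseries `∑_e ‖a_{p^e}‖² (p^{-w})^e` of the Rankin–Selberg series converges
(`w > 2`, `p` prime). [folklore] -/
theorem summable_normSq_cuspCoeff_prime_pow_mul (f : CuspForm (Gamma0 N) 2) {w : ℝ} (hw : 2 < w)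
    {p : ℕ} (hp : p.Prime) :
    Summable fun e : ℕ ↦ ‖cuspCoeff f (p ^ e)‖ ^ 2 * ((p : ℝ) ^ (-w)) ^ e := by
  have h := (summable_normSq_cuspCoeff_div_rpow f hw).comp_injective (Nat.pow_right_injective hp.two_le)
  refine h.congr fun e ↦ ?_
  simp only [Function.comp_apply]
  rw [← normSq_cuspCoeff_prime_pow_div_eq f p e w, Nat.cast_pow]

/-- **Euler product of `∑ ‖aₙ‖² n^{-w}` with its local factors in closed form** (`w > 2`): for a
newform `f ∈ S₂(Γ₀(N))`, with `x_p = p^{-w}`,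
`∑ₙ ‖aₙ‖² n^{-w} = ∏_{p ∣ N} (1 − ‖a_p‖² x_p)⁻¹ · ∏_{p ∤ N} (1 + p x_p)/((1 − p x_p)(1 − (a_p² − 2p) x_p + p² x_p²))`
(Rankin 1939; Shimura 1975: `∑ aₙ² n^{-s} = ζ_N(s−1) ζ_N(2s−2)⁻¹ L(Sym² f, s) ×` bad factors;
Bump 1997, §3.9). [cite: Bump1997, §3.9 (PDF p. 382)] -/
theorem IsNewform0.hasProd_rankinSelberg_localFactor (hf : IsNewform0 f) {w : ℝ} (hw : 2 < w) :
    HasProd (fun p : Nat.Primes ↦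
        if (p : ℕ) ∣ N then (1 - ‖cuspCoeff f p‖ ^ 2 * (p : ℝ) ^ (-w))⁻¹
        else (1 + p * (p : ℝ) ^ (-w)) /
          ((1 - p * (p : ℝ) ^ (-w)) *
            (1 - (‖cuspCoeff f p‖ ^ 2 - 2 * p) * (p : ℝ) ^ (-w) + (p : ℝ) ^ 2 * ((p : ℝ) ^ (-w)) ^ 2)))
      (∑' n : ℕ, ‖cuspCoeff f n‖ ^ 2 / (n : ℝ) ^ w) := by
  refine (hf.hasProd_tsum_normSq_cuspCoeff_prime_pow hw).congr_fun fun p ↦ ?_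
  have hp : (p : ℕ).Prime := p.2
  have hx0 : (0 : ℝ) ≤ ((p : ℕ) : ℝ) ^ (-w) := Real.rpow_nonneg (Nat.cast_nonneg _) _
  have hx1 : ((p : ℕ) : ℝ) ^ (-w) < 1 :=
    Real.rpow_lt_one_of_one_lt_of_neg (by exact_mod_cast hp.one_lt) (by linarith)
  have hs := summable_normSq_cuspCoeff_prime_pow_mul f hw hp
  rw [tsum_congr (fun e ↦ normSq_cuspCoeff_prime_pow_div_eq f p e w)]
  split_ifs with hpN
  · exact (hf.tsum_normSq_cuspCoeff_prime_pow_of_dvd hp hpN hx0 hx1).symm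
  · exact (hf.tsum_normSq_cuspCoeff_prime_pow_of_not_dvd hp hpN hx0 hs).symm

omit [NeZero N] in
/-- The primes dividing `N ≠ 0`, as a finset of `Nat.Primes`. [folklore] -/
theorem exists_finset_primes_mem_iff_dvd (hN : N ≠ 0) :
    ∃ S : Finset Nat.Primes, ∀ p : Nat.Primes, p ∈ S ↔ (p : ℕ) ∣ N := by
  have hfin : ((fun p : Nat.Primes ↦ (p : ℕ)) ⁻¹' (N.divisors : Set ℕ)).Finite :=
    N.divisors.finite_toSet.preimage Nat.Primes.coe_nat_injective.injOn
  refine ⟨hfin.toFinset, fun p ↦ ?_⟩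
  rw [Set.Finite.mem_toFinset, Set.mem_preimage, Finset.mem_coe, Nat.mem_divisors]
  exact ⟨fun h ↦ h.1, fun h ↦ ⟨h, hN⟩⟩

omit [NeZero N] in
/-- A product over the primes dividing `N ≠ 0`, indexed by `Nat.Primes`, is the product over
`N.primeFactors`. [folklore] -/
theorem prod_finset_primes_eq_prod_primeFactors (hN : N ≠ 0) {S : Finset Nat.Primes}
    (hS : ∀ p : Nat.Primes, p ∈ S ↔ (p : ℕ) ∣ N) (φ : ℕ → ℝ) :
    ∏ p ∈ S, φ p = ∏ p ∈ N.primeFactors, φ p := by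
  refine Finset.prod_nbij (fun p : Nat.Primes ↦ (p : ℕ)) (fun p hp ↦ ?_)
    (Nat.Primes.coe_nat_injective.injOn) (fun q hq ↦ ?_) (fun p _ ↦ rfl)
  · exact Nat.mem_primeFactors.mpr ⟨p.2, (hS p).mp hp, hN⟩
  · have hq' := Nat.mem_primeFactors.mp hq
    exact ⟨⟨q, hq'.1⟩, (hS ⟨q, hq'.1⟩).mpr hq'.2.1, rfl⟩

/-- **The naive symmetric-square Euler product of a newform, `w > 2`.** For a newform
`f ∈ S₂(Γ₀(N))` and real `w > 2` the product over the primes `p ∤ N` of the inverted local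
factors `L_p(Sym² f, p^{-w}) = ((1 − p·p^{-w})(1 − (a_p² − 2p) p^{-w} + p² p^{-2w}))⁻¹`
(`= ((1 − α_p² X)(1 − α_pβ_p X)(1 − β_p² X))⁻¹` at `X = p^{-w}`, `α_p + β_p = a_p`, `α_p β_p = p`)
converges, to
`(∑ₙ ‖aₙ‖² n^{-w}) · ∏_{p∣N} (1 − ‖a_p‖² p^{-w}) · ζ_N(2w − 2) / ζ_N(w − 1)`,
`ζ_N(s) = ζ(s) ∏_{p∣N} (1 − p^{-s})`, `ζ(s) = ∑_{n≥1} n^{-s}` (Rankin 1939; Shimura 1975; the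
identity `∑ |aₙ|² n^{-s} ζ_N(2s−2) = ζ_N(s−1) L(Sym² f, s) ∏_{p∣N}(1 − |a_p|²p^{-s})⁻¹`; Bump 1997,
§3.9, `L_S(s, π × π) = L_S(s, π, ∨²) L_S(s, π, ∧²)` with `∧² = 1`). [cite: Bump1997, §3.9 (PDF p. 382)] -/
theorem IsNewform0.hasProd_symmSq (hf : IsNewform0 f) {w : ℝ} (hw : 2 < w) :
    HasProd (fun p : Nat.Primes ↦ if (p : ℕ) ∣ N then (1 : ℝ) else
        ((1 - p * (p : ℝ) ^ (-w)) *
          (1 - (‖cuspCoeff f p‖ ^ 2 - 2 * p) * (p : ℝ) ^ (-w) + (p : ℝ) ^ 2 * ((p : ℝ) ^ (-w)) ^ 2))⁻¹)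
      ((∑' n : ℕ, ‖cuspCoeff f n‖ ^ 2 / (n : ℝ) ^ w) *
        (∏ p ∈ N.primeFactors, (1 - ‖cuspCoeff f p‖ ^ 2 * (p : ℝ) ^ (-w))) *
        ((∑' n : ℕ, 1 / (n : ℝ) ^ (2 * w - 2)) * ∏ p ∈ N.primeFactors, (1 - (p : ℝ) ^ (-(2 * w - 2)))) /
        ((∑' n : ℕ, 1 / (n : ℝ) ^ (w - 1)) * ∏ p ∈ N.primeFactors, (1 - (p : ℝ) ^ (-(w - 1))))) := by
  have hN : N ≠ 0 := NeZero.ne N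
  obtain ⟨S, hS'⟩ := exists_finset_primes_mem_iff_dvd hN
  have hS : ∀ p : Nat.Primes, (p : ℕ) ∣ N ↔ p ∈ S := fun p ↦ (hS' p).symm
  -- positivity / nonvanishing facts
  have hx0 : ∀ p : Nat.Primes, (0 : ℝ) ≤ ((p : ℕ) : ℝ) ^ (-w) := fun p ↦
    Real.rpow_nonneg (Nat.cast_nonneg _) _
  have hx1 : ∀ p : Nat.Primes, ((p : ℕ) : ℝ) ^ (-w) < 1 := fun p ↦
    Real.rpow_lt_one_of_one_lt_of_neg (by exact_mod_cast p.2.one_lt) (by linarith)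
  have hy : ∀ p : Nat.Primes, ((p : ℕ) : ℝ) ^ (-(w - 1)) = (p : ℝ) * ((p : ℕ) : ℝ) ^ (-w) := fun p ↦ by
    have hp : (0 : ℝ) < (p : ℕ) := by exact_mod_cast p.2.pos
    rw [show -(w - 1) = 1 + -w by ring, Real.rpow_add hp, Real.rpow_one]
  have hy2 : ∀ p : Nat.Primes, ((p : ℕ) : ℝ) ^ (-(2 * w - 2)) = ((p : ℝ) * ((p : ℕ) : ℝ) ^ (-w)) ^ 2 :=
    fun p ↦ by
    have hp : (0 : ℝ) ≤ (p : ℕ) := Nat.cast_nonneg _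
    rw [← hy p, ← Real.rpow_natCast, ← Real.rpow_mul hp]
    congr 1; push_cast; ring
  have hylt : ∀ p : Nat.Primes, (p : ℝ) * ((p : ℕ) : ℝ) ^ (-w) < 1 := fun p ↦ by
    rw [← hy p]
    exact Real.rpow_lt_one_of_one_lt_of_neg (by exact_mod_cast p.2.one_lt) (by linarith)
  have hypos : ∀ p : Nat.Primes, 0 < (p : ℝ) * ((p : ℕ) : ℝ) ^ (-w) := fun p ↦ by
    rw [← hy p]
    exact Real.rpow_pos_of_pos (by exact_mod_cast p.2.pos) _
  have hbad : ∀ p : Nat.Primes, (p : ℕ) ∣ N → 0 < 1 - ‖cuspCoeff f p‖ ^ 2 * ((p : ℕ) : ℝ) ^ (-w) := by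
    intro p hpN
    rw [hf.norm_cuspCoeff_sq_of_dvd p.2 hpN]
    split_ifs
    · rw [zero_mul, sub_zero]; exact zero_lt_one
    · rw [one_mul]; linarith [hx1 p]
  have hQ : ∀ p : Nat.Primes, ¬ (p : ℕ) ∣ N → 0 < (1 - p * ((p : ℕ) : ℝ) ^ (-w)) *
      (1 - (‖cuspCoeff f p‖ ^ 2 - 2 * p) * ((p : ℕ) : ℝ) ^ (-w) + (p : ℝ) ^ 2 * (((p : ℕ) : ℝ) ^ (-w)) ^ 2) :=
    fun p hpN ↦ hf.symmSqLocalFactor_inv_pos p.2 hpN (hx0 p) (summable_normSq_cuspCoeff_prime_pow_mul f hw p.2)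
  have hZ1 : 0 < ∑' n : ℕ, 1 / (n : ℝ) ^ (w - 1) := tsum_one_div_nat_rpow_pos (by linarith)
  have hZ2 : 0 < ∑' n : ℕ, 1 / (n : ℝ) ^ (2 * w - 2) := tsum_one_div_nat_rpow_pos (by linarith)
  -- (1) the Rankin–Selberg Euler product with its local factors in closed form
  have hE := hf.hasProd_rankinSelberg_localFactor hw
  -- (2a) correction at the bad primes (a finite product)
  have e1 : HasProd (fun p : Nat.Primes ↦
      if (p : ℕ) ∣ N then (1 - ‖cuspCoeff f p‖ ^ 2 * (p : ℝ) ^ (-w))⁻¹ else 1)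
      (∏ p ∈ S, (1 - ‖cuspCoeff f p‖ ^ 2 * (p : ℝ) ^ (-w))⁻¹) := by
    have hval : ∏ p ∈ S, (if (p : ℕ) ∣ N then (1 - ‖cuspCoeff f p‖ ^ 2 * (p : ℝ) ^ (-w))⁻¹ else 1) =
        ∏ p ∈ S, (1 - ‖cuspCoeff f p‖ ^ 2 * (p : ℝ) ^ (-w))⁻¹ :=
      Finset.prod_congr rfl fun p hp ↦ by rw [if_pos ((hS p).mpr hp)]
    rw [← hval]
    exact hasProd_prod_of_ne_finset_one fun p hp ↦ by rw [if_neg (fun h ↦ hp ((hS p).mp h))]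
  -- (2b) `∏_{p ∤ N} (1 − p^{-(2w-2)}) = ζ_N(2w − 2)⁻¹`
  have e2 : HasProd (fun p : Nat.Primes ↦ if (p : ℕ) ∣ N then (1 : ℝ) else (1 - (p : ℝ) ^ (-(2 * w - 2))))
      ((∑' n : ℕ, 1 / (n : ℝ) ^ (2 * w - 2))⁻¹ *
        ((∏ p ∈ S, (if (p : ℕ) ∣ N then (1 : ℝ) else (1 - (p : ℝ) ^ (-(2 * w - 2))))) /
          ∏ p ∈ S, (1 - (p : ℝ) ^ (-(2 * w - 2))))) := by
    have hz : HasProd (fun p : Nat.Primes ↦ (1 - (p : ℝ) ^ (-(2 * w - 2))))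
        (∑' n : ℕ, 1 / (n : ℝ) ^ (2 * w - 2))⁻¹ :=
      (hasProd_inv_of_hasProd (hasProd_one_sub_prime_rpow_neg_inv (s := 2 * w - 2) (by linarith))
        hZ2.ne').congr_fun fun p ↦ (inv_inv _).symm
    refine hz.congr_cofinite₀ (s := S) (fun p _ ↦ ?_) (fun p hp ↦ ?_)
    · rw [hy2 p]; nlinarith [hylt p, hypos p]
    · rw [if_neg (fun h ↦ hp ((hS p).mp h))]
  -- (2c) `∏_{p ∤ N} (1 − p^{-(w-1)})⁻¹ = ζ_N(w − 1)`
  have e3 : HasProd (fun p : Nat.Primes ↦ if (p : ℕ) ∣ N then (1 : ℝ) else (1 - (p : ℝ) ^ (-(w - 1)))⁻¹)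
      ((∑' n : ℕ, 1 / (n : ℝ) ^ (w - 1)) *
        ((∏ p ∈ S, (if (p : ℕ) ∣ N then (1 : ℝ) else (1 - (p : ℝ) ^ (-(w - 1)))⁻¹)) /
          ∏ p ∈ S, (1 - (p : ℝ) ^ (-(w - 1)))⁻¹)) := by
    refine (hasProd_one_sub_prime_rpow_neg_inv (s := w - 1) (by linarith)).congr_cofinite₀ (s := S)
      (fun p _ ↦ ?_) (fun p hp ↦ ?_)
    · rw [hy p]; exact inv_ne_zero (by linarith [hylt p])
    · rw [if_neg (fun h ↦ hp ((hS p).mp h))]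
  -- (3) combine: `L_p = E_p · (e1_p e2_p e3_p)⁻¹`
  have hc := (e1.mul e2).mul e3
  set V : ℝ := (∏ p ∈ S, (1 - ‖cuspCoeff f p‖ ^ 2 * (p : ℝ) ^ (-w))⁻¹) *
      ((∑' n : ℕ, 1 / (n : ℝ) ^ (2 * w - 2))⁻¹ *
        ((∏ p ∈ S, (if (p : ℕ) ∣ N then (1 : ℝ) else (1 - (p : ℝ) ^ (-(2 * w - 2))))) /
          ∏ p ∈ S, (1 - (p : ℝ) ^ (-(2 * w - 2))))) *
      ((∑' n : ℕ, 1 / (n : ℝ) ^ (w - 1)) *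
        ((∏ p ∈ S, (if (p : ℕ) ∣ N then (1 : ℝ) else (1 - (p : ℝ) ^ (-(w - 1)))⁻¹)) /
          ∏ p ∈ S, (1 - (p : ℝ) ^ (-(w - 1)))⁻¹)) with hVdef
  -- the finite products, simplified and moved to `ℕ`-indexing
  have hg2 : ∏ p ∈ S, (if (p : ℕ) ∣ N then (1 : ℝ) else (1 - (p : ℝ) ^ (-(2 * w - 2)))) = 1 :=
    Finset.prod_eq_one fun p hp ↦ by rw [if_pos ((hS p).mpr hp)]
  have hg3 : ∏ p ∈ S, (if (p : ℕ) ∣ N then (1 : ℝ) else (1 - (p : ℝ) ^ (-(w - 1)))⁻¹) = 1 :=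
    Finset.prod_eq_one fun p hp ↦ by rw [if_pos ((hS p).mpr hp)]
  have hmem : ∀ x ∈ N.primeFactors, x.Prime := fun x hx ↦ Nat.prime_of_mem_primeFactors hx
  have hP1 : ∏ p ∈ S, (1 - ‖cuspCoeff f p‖ ^ 2 * (p : ℝ) ^ (-w))⁻¹ =
      (∏ p ∈ N.primeFactors, (1 - ‖cuspCoeff f p‖ ^ 2 * (p : ℝ) ^ (-w)))⁻¹ := by
    rw [prod_finset_primes_eq_prod_primeFactors hN hS'
      (fun q : ℕ ↦ (1 - ‖cuspCoeff f q‖ ^ 2 * (q : ℝ) ^ (-w))⁻¹), Finset.prod_inv_distrib]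
  have hP2 : ∏ p ∈ S, (1 - (p : ℝ) ^ (-(2 * w - 2))) = ∏ p ∈ N.primeFactors, (1 - (p : ℝ) ^ (-(2 * w - 2))) :=
    prod_finset_primes_eq_prod_primeFactors hN hS' (fun q : ℕ ↦ (1 - (q : ℝ) ^ (-(2 * w - 2))))
  have hP3 : ∏ p ∈ S, (1 - (p : ℝ) ^ (-(w - 1)))⁻¹ = (∏ p ∈ N.primeFactors, (1 - (p : ℝ) ^ (-(w - 1))))⁻¹ := by
    rw [prod_finset_primes_eq_prod_primeFactors hN hS' (fun q : ℕ ↦ (1 - (q : ℝ) ^ (-(w - 1)))⁻¹),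
      Finset.prod_inv_distrib]
  -- nonvanishing of the three `ℕ`-indexed products
  have hB : 0 < ∏ p ∈ N.primeFactors, (1 - ‖cuspCoeff f p‖ ^ 2 * (p : ℝ) ^ (-w)) := by
    refine Finset.prod_pos fun p hp ↦ ?_
    have h := hbad ⟨p, hmem p hp⟩ (Nat.dvd_of_mem_primeFactors hp)
    exact h
  have hB2 : 0 < ∏ p ∈ N.primeFactors, (1 - (p : ℝ) ^ (-(2 * w - 2))) := by
    refine Finset.prod_pos fun p hp ↦ ?_
    have h1 := hylt ⟨p, hmem p hp⟩
    have h2 := hypos ⟨p, hmem p hp⟩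
    have h3 := hy2 ⟨p, hmem p hp⟩
    simp only at h1 h2 h3
    rw [h3]; nlinarith
  have hB3 : 0 < ∏ p ∈ N.primeFactors, (1 - (p : ℝ) ^ (-(w - 1))) := by
    refine Finset.prod_pos fun p hp ↦ ?_
    have h1 := hylt ⟨p, hmem p hp⟩
    have h3 := hy ⟨p, hmem p hp⟩
    simp only at h1 h3
    rw [h3]; linarith
  have hV : V = ((∏ p ∈ N.primeFactors, (1 - ‖cuspCoeff f p‖ ^ 2 * (p : ℝ) ^ (-w))) *
      ((∑' n : ℕ, 1 / (n : ℝ) ^ (2 * w - 2)) * ∏ p ∈ N.primeFactors, (1 - (p : ℝ) ^ (-(2 * w - 2)))))⁻¹ *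
      ((∑' n : ℕ, 1 / (n : ℝ) ^ (w - 1)) * ∏ p ∈ N.primeFactors, (1 - (p : ℝ) ^ (-(w - 1)))) := by
    rw [hVdef, hg2, hg3, hP1, hP2, hP3]
    field_simp
  have hV0 : V ≠ 0 := by rw [hV]; positivity
  have hL := hE.mul (hasProd_inv_of_hasProd hc hV0)
  have hval : (∑' n : ℕ, ‖cuspCoeff f n‖ ^ 2 / (n : ℝ) ^ w) * V⁻¹ =
      (∑' n : ℕ, ‖cuspCoeff f n‖ ^ 2 / (n : ℝ) ^ w) *
        (∏ p ∈ N.primeFactors, (1 - ‖cuspCoeff f p‖ ^ 2 * (p : ℝ) ^ (-w))) *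
        ((∑' n : ℕ, 1 / (n : ℝ) ^ (2 * w - 2)) * ∏ p ∈ N.primeFactors, (1 - (p : ℝ) ^ (-(2 * w - 2)))) /
        ((∑' n : ℕ, 1 / (n : ℝ) ^ (w - 1)) * ∏ p ∈ N.primeFactors, (1 - (p : ℝ) ^ (-(w - 1)))) := by
    rw [hV]
    field_simp
  rw [hval] at hL
  refine hL.congr_fun fun p ↦ ?_
  by_cases hpN : (p : ℕ) ∣ N
  · simp only [if_pos hpN, mul_one]
    rw [inv_inv, inv_mul_cancel₀ (hbad p hpN).ne']
  · simp only [if_neg hpN, one_mul]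
    have h1 := hQ p hpN
    have h2 := hylt p
    have h3 := hypos p
    rw [hy2 p, hy p]
    have h4 : (0 : ℝ) < 1 - p * ((p : ℕ) : ℝ) ^ (-w) := by linarith
    have h5 : (0 : ℝ) < 1 + p * ((p : ℕ) : ℝ) ^ (-w) := by linarith
    have hq : (0 : ℝ) < 1 - (‖cuspCoeff f p‖ ^ 2 - 2 * p) * ((p : ℕ) : ℝ) ^ (-w) +
        (p : ℝ) ^ 2 * (((p : ℕ) : ℝ) ^ (-w)) ^ 2 := (pos_iff_pos_of_mul_pos h1).mp h4
    have h6 : (1 : ℝ) - (p * ((p : ℕ) : ℝ) ^ (-w)) ^ 2 =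
        (1 - p * ((p : ℕ) : ℝ) ^ (-w)) * (1 + p * ((p : ℕ) : ℝ) ^ (-w)) := by ring
    rw [h6, div_eq_mul_inv]
    field_simp

end SymmSquare


section SymmSquareEdge

variable {f : CuspForm (Gamma0 N) 2}

omit [NeZero N] in
/-- **`[SL₂(ℤ) : Γ₀(N)] = N ∏_{p ∣ N} (1 + 1/p)`** as a real number, from the tree's
`gamma0Index N = ∏_{p^e ∥ N} p^{e−1}(p + 1)` (Shimura Prop. 1.43). [folklore] -/
theorem gamma0Index_eq_mul_prod (hN : N ≠ 0) :
    (gamma0Index N : ℝ) = N * ∏ p ∈ N.primeFactors, (1 + (p : ℝ)⁻¹) := by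
  have hNfac : (N : ℝ) = ∏ p ∈ N.primeFactors, (p : ℝ) ^ N.factorization p := by
    conv_lhs => rw [← Nat.prod_factorization_pow_eq_self hN]
    rw [Finsupp.prod, Nat.support_factorization, Nat.cast_prod]
    simp only [Nat.cast_pow]
  rw [hNfac, gamma0Index, Finsupp.prod, Nat.support_factorization, Nat.cast_prod,
    ← Finset.prod_mul_distrib]
  refine Finset.prod_congr rfl fun p hp ↦ ?_
  have hpr : p.Prime := Nat.prime_of_mem_primeFactors hp
  have hp0 : (p : ℝ) ≠ 0 := by exact_mod_cast hpr.ne_zero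
  have he : 0 < N.factorization p := hpr.factorization_pos_of_dvd hN (Nat.dvd_of_mem_primeFactors hp)
  obtain ⟨e, he'⟩ : ∃ e, N.factorization p = e + 1 := ⟨N.factorization p - 1, by omega⟩
  rw [he', Nat.add_sub_cancel, pow_succ]
  push_cast
  field_simp

/-- The bad-prime factor at the edge: `∏_{p ∣ N} (1 − ‖a_p‖² p^{-2}) = ∏_{p ∥ N} (1 − p^{-2})`
(`‖a_p‖² = 1` at `p ∥ N`, `= 0` at `p² ∣ N`). [cite: AtkinLehner1970, Thm. 3] -/
theorem IsNewform0.prod_one_sub_normSq_cuspCoeff_mul (hf : IsNewform0 f) :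
    ∏ p ∈ N.primeFactors, (1 - ‖cuspCoeff f p‖ ^ 2 * (p : ℝ) ^ (-(2 : ℝ))) =
      ∏ p ∈ N.primeFactors with ¬ p ^ 2 ∣ N, (1 - ((p : ℝ) ^ 2)⁻¹) := by
  rw [Finset.prod_filter]
  refine Finset.prod_congr rfl fun p hp ↦ ?_
  have hpr : p.Prime := Nat.prime_of_mem_primeFactors hp
  rw [hf.norm_cuspCoeff_sq_of_dvd hpr (Nat.dvd_of_mem_primeFactors hp),
    Real.rpow_neg (Nat.cast_nonneg p), Real.rpow_two]
  split_ifs <;> simp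

/-- **The naive symmetric-square `L`-value of a newform at the edge of convergence**
(R4 of Murty's argument; Rankin 1939, Shimura 1975; cf. the display
`L(2, sym² f) = c π³ ∏(1 − p^{-2}) (f,f)/N` in Murty 1999, §2, p. 7, whose normalisations of
`L(s, sym² f)` and `(f, f)` differ from the tree's by explicit constants). For a newform
`f ∈ S₂(Γ₀(N))`, as `w → 2⁺` the product over the good primes `p ∤ N` of the naive local
symmetric-square factors `((1 − p^{1−w})(1 − (a_p² − 2p) p^{-w} + p^{2−2w}))⁻¹`
(`= ∏ ((1 − α_p² p^{-w})(1 − α_pβ_p p^{-w})(1 − β_p² p^{-w}))⁻¹`) tends to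
`(8π³/N) · ∏_{p ∥ N} (1 − p^{-2}) · Re ⟨f, f⟩`, `⟨f,f⟩ = peterssonProduct (Gamma0 N) 2 f f`
(un-normalised, Mathlib's measure on `ℍ`). Ingredients: the Rankin–Selberg residue
`(w − 2) ∑ ‖aₙ‖² n^{-w} → 48π Re⟨f,f⟩/[SL₂(ℤ):Γ₀(N)]` (`tendsto_sub_two_mul_tsum_normSq_cuspCoeff_div_rpow`),
the Euler factorisation `hasProd_symmSq`, `(s − 1)ζ(s) → 1`, `ζ(2) = π²/6` and
`[SL₂(ℤ):Γ₀(N)] = N ∏_{p∣N}(1 + 1/p)`. [cite: Murty1999CongruencePrimes, §2 p. 7 (display for L(2, sym² f))] -/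
theorem IsNewform0.tendsto_tprod_symmSq (hf : IsNewform0 f) :
    Tendsto (fun w : ℝ ↦ ∏' p : Nat.Primes, (if (p : ℕ) ∣ N then (1 : ℝ) else
        ((1 - p * (p : ℝ) ^ (-w)) *
          (1 - (‖cuspCoeff f p‖ ^ 2 - 2 * p) * (p : ℝ) ^ (-w) + (p : ℝ) ^ 2 * ((p : ℝ) ^ (-w)) ^ 2))⁻¹))
      (𝓝[>] 2)
      (𝓝 (8 * π ^ 3 / N * (∏ p ∈ N.primeFactors with ¬ p ^ 2 ∣ N, (1 - ((p : ℝ) ^ 2)⁻¹)) *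
        (peterssonProduct (Gamma0 N) 2 f f).re)) := by
  have hN : N ≠ 0 := NeZero.ne N
  have hNpos : (0 : ℝ) < N := by exact_mod_cast NeZero.pos N
  have hmem : ∀ p ∈ N.primeFactors, (0 : ℝ) < p ∧ (1 : ℝ) < p := fun p hp ↦
    ⟨by exact_mod_cast (Nat.prime_of_mem_primeFactors hp).pos,
      by exact_mod_cast (Nat.prime_of_mem_primeFactors hp).one_lt⟩
  -- (1) the Rankin–Selberg residue
  have hD := tendsto_sub_two_mul_tsum_normSq_cuspCoeff_div_rpow f
  -- (2) the bad-prime factor is continuous at `w = 2`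
  have hB : Tendsto (fun w : ℝ ↦ ∏ p ∈ N.primeFactors, (1 - ‖cuspCoeff f p‖ ^ 2 * (p : ℝ) ^ (-w)))
      (𝓝[>] 2) (𝓝 (∏ p ∈ N.primeFactors, (1 - ‖cuspCoeff f p‖ ^ 2 * (p : ℝ) ^ (-(2 : ℝ))))) := by
    refine tendsto_nhdsWithin_of_tendsto_nhds (tendsto_finsetProd _ fun p hp ↦ ?_)
    exact tendsto_const_nhds.sub (tendsto_const_nhds.mul
      ((Real.continuousAt_const_rpow (hmem p hp).1.ne').tendsto.comp (continuous_neg.tendsto 2)))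
  -- (3) `ζ_N(2w − 2) → ζ_N(2) = (π²/6) ∏_{p∣N} (1 − p^{-2})`
  have hZ2 : Tendsto (fun w : ℝ ↦ (∑' n : ℕ, 1 / (n : ℝ) ^ (2 * w - 2)) *
        ∏ p ∈ N.primeFactors, (1 - (p : ℝ) ^ (-(2 * w - 2)))) (𝓝[>] 2)
      (𝓝 (π ^ 2 / 6 * ∏ p ∈ N.primeFactors, (1 - (p : ℝ) ^ (-(2 : ℝ))))) := by
    refine tendsto_nhdsWithin_of_tendsto_nhds ?_
    have ha : Tendsto (fun w : ℝ ↦ 2 * w - 2) (𝓝 2) (𝓝 2) :=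
      ((continuous_const.mul continuous_id).sub continuous_const).tendsto' 2 2 (by norm_num)
    have h1 : Tendsto (fun w : ℝ ↦ ∑' n : ℕ, 1 / (n : ℝ) ^ (2 * w - 2)) (𝓝 2) (𝓝 (π ^ 2 / 6)) := by
      rw [← tsum_one_div_nat_rpow_two]
      exact (continuousAt_tsum_one_div_nat_rpow (s := 2) (by norm_num)).tendsto.comp ha
    have h2 : Tendsto (fun w : ℝ ↦ ∏ p ∈ N.primeFactors, (1 - (p : ℝ) ^ (-(2 * w - 2)))) (𝓝 2)
        (𝓝 (∏ p ∈ N.primeFactors, (1 - (p : ℝ) ^ (-(2 : ℝ))))) :=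
      tendsto_finsetProd _ fun p hp ↦ tendsto_const_nhds.sub
        ((Real.continuousAt_const_rpow (hmem p hp).1.ne').tendsto.comp ha.neg)
    exact h1.mul h2
  -- (4) `(w − 2) ζ_N(w − 1) → ∏_{p∣N} (1 − p^{-1})`
  have hZ1 : Tendsto (fun w : ℝ ↦ (w - 2) * ((∑' n : ℕ, 1 / (n : ℝ) ^ (w - 1)) *
        ∏ p ∈ N.primeFactors, (1 - (p : ℝ) ^ (-(w - 1))))) (𝓝[>] 2)
      (𝓝 (1 * ∏ p ∈ N.primeFactors, (1 - (p : ℝ) ^ (-(1 : ℝ))))) := by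
    have hmap : Tendsto (fun w : ℝ ↦ w - 1) (𝓝[>] 2) (𝓝[>] 1) := by
      have h := ((continuous_sub_right (1 : ℝ)).continuousWithinAt (s := Set.Ioi (2 : ℝ))
        (x := 2)).tendsto_nhdsWithin (t := Set.Ioi (1 : ℝ))
        (fun w hw ↦ by simp only [Set.mem_Ioi] at hw ⊢; linarith)
      rw [show (2 : ℝ) - 1 = 1 by norm_num] at h
      exact h
    have h1 : Tendsto (fun w : ℝ ↦ (w - 2) * ∑' n : ℕ, 1 / (n : ℝ) ^ (w - 1)) (𝓝[>] 2) (𝓝 1) := by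
      refine (tendsto_sub_one_mul_tsum_one_div_nat_rpow.comp hmap).congr fun w ↦ ?_
      simp only [Function.comp_apply]
      congr 1
      ring
    have h2 : Tendsto (fun w : ℝ ↦ ∏ p ∈ N.primeFactors, (1 - (p : ℝ) ^ (-(w - 1)))) (𝓝[>] 2)
        (𝓝 (∏ p ∈ N.primeFactors, (1 - (p : ℝ) ^ (-(1 : ℝ))))) := by
      refine tendsto_nhdsWithin_of_tendsto_nhds ?_
      have ha : Tendsto (fun w : ℝ ↦ -(w - 1)) (𝓝 2) (𝓝 (-1)) :=
        (continuous_id.sub continuous_const).neg.tendsto' 2 (-1) (by norm_num)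
      exact tendsto_finsetProd _ fun p hp ↦ tendsto_const_nhds.sub
        ((Real.continuousAt_const_rpow (hmem p hp).1.ne').tendsto.comp ha)
    have h := h1.mul h2
    refine h.congr fun w ↦ ?_
    ring
  -- (5) nonvanishing of the denominator limit and combination
  have hP1 : 0 < ∏ p ∈ N.primeFactors, (1 - (p : ℝ) ^ (-(1 : ℝ))) := by
    refine Finset.prod_pos fun p hp ↦ ?_
    rw [Real.rpow_neg_one]
    have h := (hmem p hp).2
    have : (p : ℝ)⁻¹ < 1 := inv_lt_one_of_one_lt₀ h
    linarith
  have hlim : Tendsto (fun w : ℝ ↦ (w - 2) * (∑' n : ℕ, ‖cuspCoeff f n‖ ^ 2 / (n : ℝ) ^ w) *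
      (∏ p ∈ N.primeFactors, (1 - ‖cuspCoeff f p‖ ^ 2 * (p : ℝ) ^ (-w))) *
      ((∑' n : ℕ, 1 / (n : ℝ) ^ (2 * w - 2)) * ∏ p ∈ N.primeFactors, (1 - (p : ℝ) ^ (-(2 * w - 2)))) /
      ((w - 2) * ((∑' n : ℕ, 1 / (n : ℝ) ^ (w - 1)) * ∏ p ∈ N.primeFactors, (1 - (p : ℝ) ^ (-(w - 1))))))
      (𝓝[>] 2) (𝓝 (48 * π * (peterssonProduct (Gamma0 N) 2 f f).re / gamma0Index N *
        (∏ p ∈ N.primeFactors, (1 - ‖cuspCoeff f p‖ ^ 2 * (p : ℝ) ^ (-(2 : ℝ)))) *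
        (π ^ 2 / 6 * ∏ p ∈ N.primeFactors, (1 - (p : ℝ) ^ (-(2 : ℝ)))) /
        (1 * ∏ p ∈ N.primeFactors, (1 - (p : ℝ) ^ (-(1 : ℝ)))))) :=
    ((hD.mul hB).mul hZ2).div hZ1 (by positivity)
  -- (6) the value
  have hval : 48 * π * (peterssonProduct (Gamma0 N) 2 f f).re / gamma0Index N *
        (∏ p ∈ N.primeFactors, (1 - ‖cuspCoeff f p‖ ^ 2 * (p : ℝ) ^ (-(2 : ℝ)))) *
        (π ^ 2 / 6 * ∏ p ∈ N.primeFactors, (1 - (p : ℝ) ^ (-(2 : ℝ)))) /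
        (1 * ∏ p ∈ N.primeFactors, (1 - (p : ℝ) ^ (-(1 : ℝ)))) =
      8 * π ^ 3 / N * (∏ p ∈ N.primeFactors with ¬ p ^ 2 ∣ N, (1 - ((p : ℝ) ^ 2)⁻¹)) *
        (peterssonProduct (Gamma0 N) 2 f f).re := by
    rw [← hf.prod_one_sub_normSq_cuspCoeff_mul, gamma0Index_eq_mul_prod hN]
    have hP2 : ∏ p ∈ N.primeFactors, (1 - (p : ℝ) ^ (-(2 : ℝ))) =
        (∏ p ∈ N.primeFactors, (1 - (p : ℝ) ^ (-(1 : ℝ)))) * ∏ p ∈ N.primeFactors, (1 + (p : ℝ)⁻¹) := by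
      rw [← Finset.prod_mul_distrib]
      refine Finset.prod_congr rfl fun p hp ↦ ?_
      rw [Real.rpow_neg_one, Real.rpow_neg (Nat.cast_nonneg p), Real.rpow_two]
      ring
    have hQ : 0 < ∏ p ∈ N.primeFactors, (1 + (p : ℝ)⁻¹) :=
      Finset.prod_pos fun p hp ↦ by have := (hmem p hp).1; positivity
    rw [hP2]
    field_simp
    ring
  rw [hval] at hlim
  refine hlim.congr' ?_
  filter_upwards [self_mem_nhdsWithin] with w hw
  simp only [Set.mem_Ioi] at hw
  have hw2 : w - 2 ≠ 0 := by linarith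
  have hZ1w : 0 < ∑' n : ℕ, 1 / (n : ℝ) ^ (w - 1) := tsum_one_div_nat_rpow_pos (by linarith)
  have hP1w : 0 < ∏ p ∈ N.primeFactors, (1 - (p : ℝ) ^ (-(w - 1))) := by
    refine Finset.prod_pos fun p hp ↦ ?_
    have h : (p : ℝ) ^ (-(w - 1)) < 1 :=
      Real.rpow_lt_one_of_one_lt_of_neg (hmem p hp).2 (by linarith)
    linarith
  rw [(hf.hasProd_symmSq hw).tprod_eq]
  field_simp

/-- **`murty_petersson_newform_lower_bound` from a lower bound for the symmetric square at the
edge** (Murty 1999, §2: `(f,f) ≍ N · L(2, sym² f)` up to `∏_{p∥N}(1 − p^{-2}) ∈ (6/π², 1]`, and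
"by a result of Hoffstein and Lockhart [HL], `log (f,f) > (1−ε) log N`", i.e.
`L(2, sym² f) ≫_ε N^{-ε}` — Hoffstein–Lockhart 1994 with the appendix of
Goldfeld–Hoffstein–Lieman; `L(2, ·)` in this arithmetic normalisation is `L(1, ·)` in the
analytic one). The hypothesis is that printed input, for the naive good-prime Euler product of
`tendsto_tprod_symmSq` (which differs from the complete `L(s, sym² f)` by `≤ 3 · ω(N)` bounded
local factors at `p ∣ N`, i.e. by `N^{o(1)}`): every limit `L` of it at `w → 2⁺`, for the newform
of an elliptic curve over `ℚ` of level `N`, satisfies `L ≥ c_ε N^{-ε}`. Given that, the fact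
follows with constant `c_ε/(8π³)`. [cite: Murty1999CongruencePrimes, §2 p. 7] -/
theorem murty_petersson_newform_lower_bound_of_symmSq_lower_bound
    (h : ∀ ε : ℝ, 0 < ε → ∃ c : ℝ, 0 < c ∧
      ∀ (N : ℕ) [NeZero N] (W : WeierstrassCurve ℚ) [W.IsElliptic] (f : CuspForm (Gamma0 N) 2),
        IsNewformOf W f → ∀ L : ℝ,
          Tendsto (fun w : ℝ ↦ ∏' p : Nat.Primes, (if (p : ℕ) ∣ N then (1 : ℝ) else
            ((1 - p * (p : ℝ) ^ (-w)) *
              (1 - (‖cuspCoeff f p‖ ^ 2 - 2 * p) * (p : ℝ) ^ (-w) + (p : ℝ) ^ 2 * ((p : ℝ) ^ (-w)) ^ 2))⁻¹))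
            (𝓝[>] 2) (𝓝 L) →
          c * (N : ℝ) ^ (-ε) ≤ L) :
    murty_petersson_newform_lower_bound := by
  intro ε hε
  obtain ⟨c, hc, hcN⟩ := h ε hε
  refine ⟨c / (8 * π ^ 3), by positivity, fun N _ W _ f hf ↦ ?_⟩
  set R : ℝ := (peterssonProduct (Gamma0 N) 2 f f).re with hR
  set B : ℝ := ∏ p ∈ N.primeFactors with ¬ p ^ 2 ∣ N, (1 - ((p : ℝ) ^ 2)⁻¹) with hB
  have hNpos : (0 : ℝ) < N := by exact_mod_cast NeZero.pos N
  have hL := hf.1.tendsto_tprod_symmSq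
  have hcL : c * (N : ℝ) ^ (-ε) ≤ 8 * π ^ 3 / N * B * R := hcN N W f hf _ hL
  have hR0 : 0 ≤ R := (hf.peterssonProduct_re_pos).le
  have hB1 : B ≤ 1 := by
    refine Finset.prod_le_one (fun p hp ↦ ?_) (fun p hp ↦ ?_)
    · have h1 : (1 : ℝ) < p := by
        exact_mod_cast (Nat.prime_of_mem_primeFactors (Finset.mem_filter.mp hp).1).one_lt
      have : ((p : ℝ) ^ 2)⁻¹ ≤ 1 := inv_le_one_of_one_le₀ (by nlinarith)
      linarith
    · have h1 : (0 : ℝ) < p := by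
        exact_mod_cast (Nat.prime_of_mem_primeFactors (Finset.mem_filter.mp hp).1).pos
      have : 0 ≤ ((p : ℝ) ^ 2)⁻¹ := by positivity
      linarith
  have h1 : 8 * π ^ 3 / N * B * R ≤ 8 * π ^ 3 / N * R := by
    have h8 : 0 ≤ 8 * π ^ 3 / N := by positivity
    calc 8 * π ^ 3 / N * B * R = (8 * π ^ 3 / N) * (B * R) := by ring
      _ ≤ (8 * π ^ 3 / N) * (1 * R) := by gcongr
      _ = 8 * π ^ 3 / N * R := by ring
  have h2 : c * (N : ℝ) ^ (-ε) ≤ 8 * π ^ 3 / N * R := hcL.trans h1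
  have hπ : (0 : ℝ) < 8 * π ^ 3 := by positivity
  calc c / (8 * π ^ 3) * (N : ℝ) ^ (1 - ε) = (N / (8 * π ^ 3)) * (c * (N : ℝ) ^ (-ε)) := by
        rw [show (1 : ℝ) - ε = 1 + -ε by ring, Real.rpow_add hNpos, Real.rpow_one]; ring
    _ ≤ (N / (8 * π ^ 3)) * (8 * π ^ 3 / N * R) := by gcongr
    _ = R := by field_simp

end SymmSquareEdge



section EllipticCurve

variable {W : WeierstrassCurve ℚ} {f : CuspForm (Gamma0 N) 2}

/-- For the newform of a Weierstrass curve `W / ℚ`, `‖aₙ(f)‖² = aₙ(W)²` (`aₙ(f) = aₙ(W) ∈ ℤ`,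
Mathlib's `WeierstrassCurve.LFunction`). [folklore] -/
theorem IsNewformOf.norm_cuspCoeff_sq_eq (hf : IsNewformOf W f) (n : ℕ) :
    ‖cuspCoeff f n‖ ^ 2 = ((W.LFunction n : ℤ) : ℝ) ^ 2 := by
  rw [hf.2 n, Complex.norm_intCast, sq_abs]

/-- **The symmetric square of an elliptic curve over `ℚ` at the edge, arithmetic form.** For the
newform `f ∈ S₂(Γ₀(N))` of `W / ℚ` (`IsNewformOf W f`), the naive good-prime Euler product
`∏_{p ∤ N} ((1 − p^{1−w})(1 − (a_p(W)² − 2p) p^{-w} + p^{2−2w}))⁻¹`, built from the integers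
`a_p(W)` alone (`W.LFunction p`), tends to `(8π³/N) ∏_{p ∥ N}(1 − p^{-2}) Re(f, f)` as `w → 2⁺`
(`IsNewform0.tendsto_tprod_symmSq` with `aₙ(f) = aₙ(W)`; Murty 1999, §2 p. 7).
[cite: Murty1999CongruencePrimes, §2 p. 7 (display for L(2, sym² f))] -/
theorem IsNewformOf.tendsto_tprod_symmSq (hf : IsNewformOf W f) :
    Tendsto (fun w : ℝ ↦ ∏' p : Nat.Primes, (if (p : ℕ) ∣ N then (1 : ℝ) else
        ((1 - p * (p : ℝ) ^ (-w)) *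
          (1 - (((W.LFunction p : ℤ) : ℝ) ^ 2 - 2 * p) * (p : ℝ) ^ (-w) +
            (p : ℝ) ^ 2 * ((p : ℝ) ^ (-w)) ^ 2))⁻¹))
      (𝓝[>] 2)
      (𝓝 (8 * π ^ 3 / N * (∏ p ∈ N.primeFactors with ¬ p ^ 2 ∣ N, (1 - ((p : ℝ) ^ 2)⁻¹)) *
        (peterssonProduct (Gamma0 N) 2 f f).re)) := by
  simp_rw [← hf.norm_cuspCoeff_sq_eq]
  exact hf.1.tendsto_tprod_symmSq

/-- **`murty_petersson_newform_lower_bound` from the Hoffstein–Lockhart input in arithmetic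
form.** The fact follows from: for every `ε > 0` there is `c > 0` such that for every level `N`,
every elliptic curve `W / ℚ` with newform `f ∈ S₂(Γ₀(N))`, every limit `L` at `w → 2⁺` of the
naive good-prime symmetric-square Euler product of `W` (integers `a_p(W)` only) satisfies
`c N^{-ε} ≤ L` — the printed input "by a result of Hoffstein and Lockhart [HL],
`log (f,f) > (1−ε) log N`" of Murty 1999, §2, in the form `L(2, sym² E) ≫_ε N^{-ε}`
(Hoffstein–Lockhart 1994 with the appendix of Goldfeld–Hoffstein–Lieman).
[cite: Murty1999CongruencePrimes, §2 p. 7] -/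
theorem murty_petersson_newform_lower_bound_of_symmSq_lower_bound_lFunction
    (h : ∀ ε : ℝ, 0 < ε → ∃ c : ℝ, 0 < c ∧
      ∀ (N : ℕ) [NeZero N] (W : WeierstrassCurve ℚ) [W.IsElliptic] (f : CuspForm (Gamma0 N) 2),
        IsNewformOf W f → ∀ L : ℝ,
          Tendsto (fun w : ℝ ↦ ∏' p : Nat.Primes, (if (p : ℕ) ∣ N then (1 : ℝ) else
            ((1 - p * (p : ℝ) ^ (-w)) *
              (1 - (((W.LFunction p : ℤ) : ℝ) ^ 2 - 2 * p) * (p : ℝ) ^ (-w) +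
                (p : ℝ) ^ 2 * ((p : ℝ) ^ (-w)) ^ 2))⁻¹))
            (𝓝[>] 2) (𝓝 L) →
          c * (N : ℝ) ^ (-ε) ≤ L) :
    murty_petersson_newform_lower_bound := by
  refine murty_petersson_newform_lower_bound_of_symmSq_lower_bound fun ε hε ↦ ?_
  obtain ⟨c, hc, hcN⟩ := h ε hε
  refine ⟨c, hc, fun N _ W _ f hf L hL ↦ hcN N W f hf L ?_⟩
  simp_rw [← hf.norm_cuspCoeff_sq_eq]
  exact hL

end EllipticCurve

end Literature.NumberTheory.EllipticCurves.ModularForms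

end
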